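import Literature.AlgebraicGeometry.Resolution.KummerRootCover
import Literature.AlgebraicGeometry.Resolution.IntegrallyClosedRetract
import Mathlib.Data.ZMod.Basic
import Mathlib.RingTheory.IntegralClosure.Algebra.Basic
import HarnessLib

/-!
# The Kummer toric algebra inside the root cover, and its normality

Topic: `Literature/AlgebraicGeometry/Resolution`. DEFINITION with structure theory (all proved).
Inside the root cover `B' = O[s_1, …, s_r]/(s_j^p - x_j)` (`KummerRootCover.lean`, with its
`O`-basis of box monomials `s^n`, `0 ≤ n_j < p`) sits the **toric algebra** of the normalised
Kummer cover `τ^p = x^c` (`c_{j₀} = 1`): the `O`-span of the monomials `s^n` with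
`n̄ ∈ 𝔽_p · c̄ ⊆ (ℤ/p)ʳ` (`IsKummerExp`), i.e. of the `τ^i / x^{⌊ic/p⌋} = s^{(ic) mod p}` — the
algebra `O ⊗_{ℤ[ℕʳ]} ℤ[P]` of the Kummer cone `P` (`KummerCone.lean`), K. Kato, *Toric
singularities*, Amer. J. Math. 116 (1994), (2.2)(2). It is the degree-zero part of `B'` for
the grading by the finite group `(ℤ/p)ʳ / 𝔽_p c̄`, realised here through the PROJECTOR
`proj` keeping the coordinates at Kummer exponents; the key identity `proj (t y) = t proj y`
for `t` toric (`proj_mul_of_proj_eq`) makes `proj` a linear retraction over the toric algebra,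
whence (`IntegrallyClosedRetract.lean`) **the toric algebra is integrally closed as soon as the
root cover is an integrally closed domain** (`isIntegrallyClosed_toric`; e.g. for a regular local
`O` with regular parameters `x_j`, `KummerRootCoverRegular.lean`) — Kato's Thm. (4.1)
(log regular ⇒ normal) for this chart, by hand.

* `RootCover.addBox`, `carry`, `boxMonomial_mul` — the multiplication table of the monomials;
* `RootCover.IsKummerExp` (decidable), closure properties;
* `RootCover.proj`, `proj_boxMonomial`, `proj_boxMonomial_mul`, `proj_mul_of_proj_eq`;
* `RootCover.toric` (a subalgebra), `mem_toric_iff`, `mem_toric_iff_coord`,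
  `boxMonomial_mem_toric`, `RootCover.retraction`, `isIntegrallyClosed_toric`.

What is NOT here: locality of the toric algebra, its quotient by the monomial ideal, the
identification of its fraction field / with the integral closure of `O[τ]`, log regularity.

Sources: [Kato1994] K. Kato, Amer. J. Math. 116 (1994), (2.2)(2), Thm. (4.1).
-/

noncomputable section

namespace Literature.AlgebraicGeometry.Resolution

open MvPolynomial

namespace RootCover

variable {O : Type*} [CommRing O] {r : ℕ} {p : ℕ} [hp : Fact p.Prime] {x : Fin r → O}

/-! ## The multiplication table of the box monomials -/

/-- Sum of two box exponents, reduced modulo `p`. [folklore] -/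
def addBox (n m : Fin r → Fin p) : Fin r → Fin p :=
  fun j => ⟨((n j : ℕ) + m j) % p, Nat.mod_lt _ hp.out.pos⟩

variable (x) in
/-- The carry `∏ x_j^{(n_j + m_j) / p}` of the product of two box monomials. [folklore] -/
def carry (n m : Fin r → Fin p) : O := ∏ j, x j ^ (((n j : ℕ) + m j) / p)

/-- **Multiplication table**: `s^n · s^m = x^{(n+m)/p} · s^{(n+m) mod p}`.
[cite: Kato1994, (2.2)(2)] -/
theorem boxMonomial_mul (n m : Fin r → Fin p) :
    boxMonomial p x n * boxMonomial p x m = carry x n m • boxMonomial p x (addBox n m) := by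
  rw [boxMonomial, boxMonomial, boxMonomial, ← Finset.prod_mul_distrib, carry, Algebra.smul_def,
    map_prod, ← Finset.prod_mul_distrib]
  refine Finset.prod_congr rfl fun j _ => ?_
  rw [← pow_add, root_pow_eq j ((n j : ℕ) + m j), map_pow]
  rfl

/-! ## Kummer exponents: the subgroup `𝔽_p · c̄` of `(ℤ/p)ʳ` -/

variable (p) in
/-- **Kummer exponents**: the box exponents `n` with `n̄ ∈ 𝔽_p · c̄ ⊆ (ℤ/p)ʳ`, i.e.
`n_j ≡ c_j n_{j₀} (mod p)` for all `j` (for `c_{j₀} = 1` these are the residues of the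
multiples `i·c`): the exponents of the monomials `τ^i / x^{⌊ic/p⌋}`, `τ = s^c`, spanning the
normalised Kummer cover `τ^p = x^c` inside the root cover. [cite: Kato1994, (2.2)(2)] -/
def IsKummerExp (j₀ : Fin r) (c : Fin r → ℕ) (n : Fin r → Fin p) : Prop :=
  ∀ j, ((n j : ℕ) : ZMod p) = (c j : ZMod p) * ((n j₀ : ℕ) : ZMod p)

/-- Being a Kummer exponent is decidable. [folklore] -/
instance (j₀ : Fin r) (c : Fin r → ℕ) : DecidablePred (IsKummerExp p j₀ c) :=
  fun n => inferInstanceAs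
    (Decidable (∀ j, ((n j : ℕ) : ZMod p) = (c j : ZMod p) * ((n j₀ : ℕ) : ZMod p)))

variable {j₀ : Fin r} {c : Fin r → ℕ}

/-- The zero exponent is a Kummer exponent. [folklore] -/
theorem isKummerExp_zero : IsKummerExp p j₀ c 0 := fun _ => by simp

/-- Kummer exponents are closed under addition modulo `p`. [folklore] -/
theorem isKummerExp_addBox {n m : Fin r → Fin p} (hn : IsKummerExp p j₀ c n)
    (hm : IsKummerExp p j₀ c m) : IsKummerExp p j₀ c (addBox n m) := by
  intro j
  simp only [addBox, Fin.val_mk, ZMod.natCast_mod, Nat.cast_add]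
  rw [hn j, hm j]
  ring

/-- If `n` and `n + m` are Kummer exponents, so is `m`. [folklore] -/
theorem isKummerExp_of_addBox {n m : Fin r → Fin p} (hn : IsKummerExp p j₀ c n)
    (hnm : IsKummerExp p j₀ c (addBox n m)) : IsKummerExp p j₀ c m := by
  intro j
  have h1 := hnm j
  simp only [addBox, Fin.val_mk, ZMod.natCast_mod, Nat.cast_add] at h1
  rw [hn j] at h1
  linear_combination h1

/-- `n + m` is a Kummer exponent iff `m` is, when `n` is. [folklore] -/
theorem isKummerExp_addBox_iff {n m : Fin r → Fin p} (hn : IsKummerExp p j₀ c n) :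
    IsKummerExp p j₀ c (addBox n m) ↔ IsKummerExp p j₀ c m :=
  ⟨isKummerExp_of_addBox hn, isKummerExp_addBox hn⟩

/-! ## The projector onto the Kummer part and the toric subalgebra -/

variable (p x j₀ c) in
/-- **The projector onto the Kummer part**: keep the coordinates at Kummer exponents,
`b ↦ ∑_{n Kummer} coord_n(b) · s^n` (the projection onto the degree-zero part for the grading of
the root cover by `(ℤ/p)ʳ / 𝔽_p c̄`). [cite: Kato1994, (2.2)(2)] -/
def proj : RootCover p x →ₗ[O] RootCover p x :=
  ∑ n ∈ Finset.univ.filter (IsKummerExp p j₀ c), (LinearMap.proj n ∘ₗ coord).smulRight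
    (boxMonomial p x n)

/-- Formula for the projector. [folklore] -/
theorem proj_apply (b : RootCover p x) :
    proj p x j₀ c b = ∑ n ∈ Finset.univ.filter (IsKummerExp p j₀ c), coord b n • boxMonomial p x n := by
  simp [proj, LinearMap.sum_apply]

/-- The projector on a box monomial. [folklore] -/
theorem proj_boxMonomial (n : Fin r → Fin p) :
    proj p x j₀ c (boxMonomial p x n) = if IsKummerExp p j₀ c n then boxMonomial p x n else 0 := by
  rw [proj_apply]
  simp only [coord_boxMonomial, Pi.single_apply, ite_smul, one_smul, zero_smul]
  rw [Finset.sum_ite_eq']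
  simp only [Finset.mem_filter, Finset.mem_univ, true_and]

/-- Every element is the sum of its coordinates times the box monomials. [folklore] -/
theorem sum_coord_smul_boxMonomial (b : RootCover p x) :
    ∑ n, coord b n • boxMonomial p x n = b := by
  conv_rhs => rw [← (basis p x).sum_repr b]
  simp only [basis_apply, coord_apply_eq_repr]

/-- **Key multiplicativity**: for a Kummer monomial `s^n`, `proj (s^n · y) = s^n · proj y`
(multiplication by a degree-zero element preserves the grading). [cite: Kato1994, (2.2)(2)] -/
theorem proj_boxMonomial_mul {n : Fin r → Fin p} (hn : IsKummerExp p j₀ c n) (y : RootCover p x) :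
    proj p x j₀ c (boxMonomial p x n * y) = boxMonomial p x n * proj p x j₀ c y := by
  -- both sides are `O`-linear in `y`; check on the basis
  have key : ∀ m : Fin r → Fin p, proj p x j₀ c (boxMonomial p x n * boxMonomial p x m) =
      boxMonomial p x n * proj p x j₀ c (boxMonomial p x m) := by
    intro m
    rw [boxMonomial_mul, map_smul, proj_boxMonomial, proj_boxMonomial]
    by_cases hm : IsKummerExp p j₀ c m
    · rw [if_pos ((isKummerExp_addBox_iff hn).mpr hm), if_pos hm, boxMonomial_mul]
    · rw [if_neg (fun h => hm ((isKummerExp_addBox_iff hn).mp h)), if_neg hm, smul_zero, mul_zero]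
  conv_lhs => rw [← sum_coord_smul_boxMonomial y]
  conv_rhs => rw [← sum_coord_smul_boxMonomial y]
  rw [Finset.mul_sum, map_sum, map_sum, Finset.mul_sum]
  refine Finset.sum_congr rfl fun m _ => ?_
  rw [mul_smul_comm, map_smul, map_smul, key, mul_smul_comm]

/-- `proj (b · y) = b · proj y` whenever `proj b = b`. [cite: Kato1994, (2.2)(2)] -/
theorem proj_mul_of_proj_eq {b : RootCover p x} (hb : proj p x j₀ c b = b) (y : RootCover p x) :
    proj p x j₀ c (b * y) = b * proj p x j₀ c y := by
  have hb' := proj_apply (j₀ := j₀) (c := c) b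
  rw [hb] at hb'
  conv_lhs => rw [hb', Finset.sum_mul, map_sum]
  conv_rhs => rw [hb', Finset.sum_mul]
  refine Finset.sum_congr rfl fun n hn => ?_
  rw [smul_mul_assoc, map_smul, proj_boxMonomial_mul (Finset.mem_filter.mp hn).2, smul_mul_assoc]

/-- The projector is idempotent. [folklore] -/
theorem proj_proj (b : RootCover p x) : proj p x j₀ c (proj p x j₀ c b) = proj p x j₀ c b := by
  rw [proj_apply b, map_sum]
  refine Finset.sum_congr rfl fun n hn => ?_
  rw [map_smul, proj_boxMonomial, if_pos (Finset.mem_filter.mp hn).2]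

/-- The projector fixes `1`. [folklore] -/
theorem proj_one : proj p x j₀ c 1 = 1 := by
  have : (1 : RootCover p x) = boxMonomial p x 0 := by simp [boxMonomial]
  rw [this, proj_boxMonomial, if_pos isKummerExp_zero]

variable (p x j₀ c) in
/-- **The Kummer toric algebra** `T = 𝒪 ⊗_{ℤ[ℕʳ]} ℤ[P]` realised inside the root cover: the
elements all of whose coordinates at non-Kummer exponents vanish (the fixed points of the
projector), i.e. the `O`-span of the monomials `s^n` with `n̄ ∈ 𝔽_p c̄` — for `c_{j₀} = 1`, of the
`τ^i / x^{⌊ic/p⌋}`, `τ = s^c`. It is a subalgebra. [cite: Kato1994, (2.2)(2)] -/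
def toric : Subalgebra O (RootCover p x) where
  carrier := {b | proj p x j₀ c b = b}
  mul_mem' {a b} ha hb := by
    change proj p x j₀ c (a * b) = a * b
    rw [proj_mul_of_proj_eq ha, hb]
  one_mem' := proj_one
  add_mem' {a b} ha hb := by
    change proj p x j₀ c (a + b) = a + b
    rw [map_add, ha, hb]
  zero_mem' := map_zero _
  algebraMap_mem' a := by
    change proj p x j₀ c (algebraMap O _ a) = algebraMap O _ a
    rw [Algebra.algebraMap_eq_smul_one, map_smul, proj_one]

/-- Membership in the toric algebra: fixed by the projector (`rfl`). [folklore] -/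
theorem mem_toric_iff {b : RootCover p x} : b ∈ toric p x j₀ c ↔ proj p x j₀ c b = b := Iff.rfl

/-- Membership in the toric algebra: all coordinates at non-Kummer exponents vanish.
[cite: Kato1994, (2.2)(2)] -/
theorem mem_toric_iff_coord {b : RootCover p x} :
    b ∈ toric p x j₀ c ↔ ∀ n, ¬ IsKummerExp p j₀ c n → coord b n = 0 := by
  rw [mem_toric_iff]
  constructor
  · intro hb n hn
    rw [← hb, proj_apply, map_sum, Finset.sum_apply]
    refine Finset.sum_eq_zero fun m hm => ?_
    rw [map_smul, Pi.smul_apply, coord_boxMonomial, Pi.single_apply, if_neg, smul_zero]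
    rintro rfl
    exact hn (Finset.mem_filter.mp hm).2
  · intro h
    rw [proj_apply, Finset.sum_filter]
    conv_rhs => rw [← sum_coord_smul_boxMonomial b]
    refine Finset.sum_congr rfl fun n _ => ?_
    split_ifs with hn
    · rfl
    · rw [h n hn, zero_smul]

/-- Kummer monomials lie in the toric algebra. [cite: Kato1994, (2.2)(2)] -/
theorem boxMonomial_mem_toric {n : Fin r → Fin p} (hn : IsKummerExp p j₀ c n) :
    boxMonomial p x n ∈ toric p x j₀ c := by
  rw [mem_toric_iff, proj_boxMonomial, if_pos hn]

/-- The projector lands in the toric algebra. [folklore] -/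
theorem proj_mem_toric (b : RootCover p x) : proj p x j₀ c b ∈ toric p x j₀ c := proj_proj b

variable (p x j₀ c) in
/-- The projector as a `T`-linear retraction of the root cover onto the toric algebra `T`.
[cite: Kato1994, (2.2)(2)] -/
def retraction : RootCover p x →ₗ[toric p x j₀ c] toric p x j₀ c where
  toFun b := ⟨proj p x j₀ c b, proj_mem_toric b⟩
  map_add' a b := Subtype.ext (map_add _ a b)
  map_smul' t b := Subtype.ext (by
    change proj p x j₀ c ((t : RootCover p x) * b) = (t : RootCover p x) * proj p x j₀ c b
    exact proj_mul_of_proj_eq t.2 b)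

/-- The retraction is the identity on the toric algebra. [folklore] -/
theorem retraction_algebraMap (t : toric p x j₀ c) :
    retraction p x j₀ c (algebraMap (toric p x j₀ c) (RootCover p x) t) = t :=
  Subtype.ext t.2

/-- **The toric algebra is integrally closed whenever the root cover is an integrally closed
domain** (e.g. a regular local ring): it is a linear retract over which the cover is integral
(Kato 1994, Thm. (4.1) for this chart: the normalised Kummer cover is normal).
[cite: Kato1994, Thm. (4.1)] -/
theorem isIntegrallyClosed_toric [IsDomain (RootCover p x)] [IsIntegrallyClosed (RootCover p x)] :
    IsIntegrallyClosed (toric p x j₀ c) := by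
  haveI : Module.Finite O (RootCover p x) := inferInstance
  haveI : Algebra.IsIntegral (toric p x j₀ c) (RootCover p x) := by
    haveI : Algebra.IsIntegral O (RootCover p x) := inferInstance
    exact Algebra.IsIntegral.tower_top (R := O)
  exact IsIntegrallyClosed.of_linear_retraction (T := toric p x j₀ c) (B := RootCover p x)
    Subtype.val_injective (retraction p x j₀ c) retraction_algebraMap

/-! ## The monomial basis of the toric algebra -/

variable (p x j₀ c) in
/-- The Kummer monomials as elements of the toric algebra. [cite: Kato1994, (2.2)(2)] -/
def kummerMonomial (n : {n : Fin r → Fin p // IsKummerExp p j₀ c n}) : toric p x j₀ c :=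
  ⟨boxMonomial p x n.1, boxMonomial_mem_toric n.2⟩

/-- Underlying element of a Kummer monomial (`rfl`). [folklore] -/
@[simp] theorem coe_kummerMonomial (n : {n : Fin r → Fin p // IsKummerExp p j₀ c n}) :
    (kummerMonomial p x j₀ c n : RootCover p x) = boxMonomial p x n.1 := rfl

/-- An element of the toric algebra is the sum of its coordinates at Kummer exponents times the
Kummer monomials. [folklore] -/
theorem sum_coord_smul_kummerMonomial (t : toric p x j₀ c) :
    ∑ n : {n : Fin r → Fin p // IsKummerExp p j₀ c n}, coord (t : RootCover p x) n.1 •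
      kummerMonomial p x j₀ c n = t := by
  apply Subtype.ext
  have ht : proj p x j₀ c t = t := t.2
  conv_rhs => rw [← ht, proj_apply, ← Finset.sum_subtype_eq_sum_filter]
  simp only [AddSubmonoidClass.coe_finsetSum, Subalgebra.coe_smul, coe_kummerMonomial]
  exact Finset.sum_congr (by ext n; simp) fun _ _ => rfl

/-- The Kummer monomials are linearly independent in the toric algebra. [folklore] -/
theorem linearIndependent_kummerMonomial : LinearIndependent O (kummerMonomial p x j₀ c) := by
  refine LinearIndependent.of_comp (toric p x j₀ c).val.toLinearMap ?_
  have : (toric p x j₀ c).val.toLinearMap ∘ kummerMonomial p x j₀ c =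
      boxMonomial p x ∘ (Subtype.val : {n // IsKummerExp p j₀ c n} → _) := rfl
  rw [this]
  exact linearIndependent_boxMonomial.comp _ Subtype.val_injective

variable (p x j₀ c) in
/-- **The monomial basis of the toric algebra**: the Kummer monomials `s^n`, `n̄ ∈ 𝔽_p c̄`.
[cite: Kato1994, (2.2)(2)] -/
def toricBasis : Module.Basis {n : Fin r → Fin p // IsKummerExp p j₀ c n} O (toric p x j₀ c) :=
  Module.Basis.mk linearIndependent_kummerMonomial (by
    intro t _
    rw [← sum_coord_smul_kummerMonomial t]
    exact Submodule.sum_mem _ fun n _ =>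
      Submodule.smul_mem _ _ (Submodule.subset_span ⟨n, rfl⟩))

/-- The basis vectors are the Kummer monomials. [folklore] -/
@[simp] theorem toricBasis_apply (n : {n : Fin r → Fin p // IsKummerExp p j₀ c n}) :
    toricBasis p x j₀ c n = kummerMonomial p x j₀ c n :=
  Module.Basis.mk_apply _ _ n

/-- The coordinates in the toric basis are the coordinates in the root cover. [folklore] -/
theorem toricBasis_repr (t : toric p x j₀ c) (n : {n : Fin r → Fin p // IsKummerExp p j₀ c n}) :
    (toricBasis p x j₀ c).repr t n = coord (t : RootCover p x) n.1 := by
  classical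
  have h := (toricBasis p x j₀ c).repr_sum_self
    (fun m : {n // IsKummerExp p j₀ c n} => coord (t : RootCover p x) m.1)
  simp only [toricBasis_apply, sum_coord_smul_kummerMonomial] at h
  rw [h]

/-- The toric algebra is a free `O`-module. [folklore] -/
instance toric_free : Module.Free O (toric p x j₀ c) := Module.Free.of_basis (toricBasis p x j₀ c)

/-- The toric algebra is a finite `O`-module. [folklore] -/
instance toric_finite : Module.Finite O (toric p x j₀ c) :=
  Module.Finite.of_basis (ι := {n : Fin r → Fin p // IsKummerExp p j₀ c n}) (toricBasis p x j₀ c)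

end RootCover

end Literature.AlgebraicGeometry.Resolution

end
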